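import Summits.CriticalPhenomena.PercolationContinuityZ3.Theorems.PercNearOneGluingNoHeavyLowerTailSahiE3HitSlotCertificate
import Literature.Combinatorics.Sahi2008.Indicators
import Mathlib.Tactic.Linarith
import Mathlib.Tactic.Ring
import Mathlib.Tactic.Positivity
import HarnessLib
import HarnessLib.Audit

/-!
# `NoHeavyLowerTail` (crux stmt-CriticalPhenomena-4575), Sahi programme P4 (Holley / monotone coupling):
# FKG slot-locality for an ARBITRARY JUNTA PATTERN — Sahi's `E₃ ≥ 0` from a "flow certificate" on the pattern measure

Support file (cell `prim-l12`, seat P4, generation 8; `--supports stmt-CriticalPhenomena-4575`).  No named facts, no sorries; standard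
axioms; def-free.

This generalises `…SahiE3SlotCertificate.phi_nonneg_of_certificate` (the pattern slot "all fibres but `⊥`", i.e. hitting sets of
join-primes) to an ARBITRARY set `U` of fibres of a finite pattern `P` (in the application: `P = (ι → Bool)`, the image of
`x ↦ (j_i ≤ x)_i` for join-primes `j_i`, and `U` any up-set of patterns — e.g. the majority pattern `maj(j₁,j₂,j₃)`, `↑j₁ ∪ ↑(j₂ ⊔ j₃)`,
…; fibre masses `ν`, fibre densities `α, β, γ` of `A, B, A ∩ B`).  Sahi's functional `Z³·E₃(1_U, 1_A, 1_B)` written in fibre data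
is the cubic displayed in `phi_nonneg_of_patternCertificate`.

THEOREM `phi_nonneg_of_patternCertificate`.  Let `ν` be fibre masses (their sign is never used), `α, β ≥ 0` monotone, `γ` monotone with `γ ≥ α·β` (all consequences of the
four functions theorem in the application).  Write `Z = Σ ν`, `N_U = Σ_{t∈U} ν`, `N_D = Σ_{t∉U} ν`, `N(S) = Σ_{t∈S} ν`,
`N_U(S) = Σ_{t∈S∩U} ν`.  A FLOW CERTIFICATE is `R : P → ℝ` (retained mass on `U`) and `F : P → P → ℝ` (mass `F t s` sent from
`t ∈ U` DOWN to `s ∉ U`, `s ≤ t`) with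
  (R0) `0 ≤ R t`,  (F0) `0 ≤ F t s`,  (F≤) `F t s ≠ 0 → s ≤ t`,  (cap) `R t + Σ_{s∉U} F t s ≤ Z(Z+N_D)·ν t`  (`t ∈ U`),
  (K)  `Z·N_U·ν s ≤ Σ_{t∈U} F t s`  (`s ∉ U`; write `K s` for the difference),
  (pair) for all up-sets `S, S'` of `P` (`W = S ∩ S'`):
       `Σ_{t∈W∩U} R t + Σ_{s∈W∖U} K s ≥ Z·(N(S)·N_U(S') + N(S')·N_U(S)) − N_U·N(S)·N(S')`.
Then `Z³E₃ ≥ 0`.  For `U = P ∖ {⊥}` the conditions are exactly the ρ-lemma (a)–(d) of HOME prim-l12-p4/RHO-LEMMA-gen6.md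
(`R = Z(Z+ν_⊥)ν − T`, all flow into `⊥`, `K ⊥ = 0`).  Numerically (this generation, kit jobs recorded in HOME STATUS) the certificate LP
is feasible for every sampled FKG pattern measure on `2³` for EVERY pattern `U` (and is being censused on `2⁴`); its existence in general
is the open combinatorial problem of the programme.

LATTICE FORM `latticeE3_nonneg_of_patternCertificate`.  `L` finite distributive, `μ ≥ 0` log-supermodular (zeros allowed), `j : ι → L`
join-primes with pattern fibres `F_t = {x | ∀ i, j i ≤ x ↔ t i}` (`hF`), `ν_t = m(F_t)`, `A, B` up-sets, `U'` ANY set of patterns and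
`U = {x | (j i ≤ x)_i ∈ U'}` its preimage: a flow certificate for `(U', ν)` gives `0 ≤ latticeE3 μ U A B`.  The lattice side
(one Ahlswede–Daykin inequality across fibres ⟹ monotone phantom densities, Harris in each fibre) is imported from
`…SahiE3HitSlotCertificate`; the only new point is that `γ` (density of `A ∩ B`, phantom value `max(env, α·β)`) is MONOTONE.
So for every junta slot (cube: `U` depending on coordinates `I`, pattern `2^I`) Sahi's `C₃` under every FKG measure on every finite
distributive lattice is reduced to the existence of a flow certificate for every FKG pattern measure on the fixed finite pattern.

PROOF.  (1) For `t ∈ U` the coefficient `Z(Z+N_D)ν_t` of `γ_t` dominates `R t + Σ_s F t s`; bound `γ_t ≥ α_tβ_t` against `R t` and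
`γ_t ≥ γ_s` (`s ≤ t`) against `F t s` — the flow carries `γ`-mass down onto `P ∖ U`, where the coefficient of `γ_s` is `−Z·N_U·ν_s`;
by (K) the net coefficient `K s ≥ 0` and `γ_s ≥ α_sβ_s` applies again.  (2) What is left is a bilinear form `Q(α, β)`; by the layer
cake (`Literature…exists_upperSet_decomposition`, generic lemma `bilin_nonneg_of_upperSets`) it suffices to check it on pairs of
indicators of up-sets, which is (pair).
-/

namespace Summit.CriticalPhenomena.PercolationContinuityZ3.Theorems.SahiE3PatternCertificate

open Finset Literature.Combinatorics.Sahi2008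
open scoped BigOperators

variable {P : Type*} [Fintype P] [DecidableEq P] [PartialOrder P]

/-! ### Generic: a bilinear form nonnegative on indicators of up-sets is nonnegative on nonnegative monotone functions -/

omit [Fintype P] in
/-- One-sided layer cake: if `Q(·, h)` is additive and homogeneous and nonnegative on indicators of up-sets, it is nonnegative on
every layer-cake list sum with nonnegative coefficients. [folklore] -/
theorem listSum_nonneg_of_upperSets (Q : (P → ℝ) → (P → ℝ) → ℝ) (h : P → ℝ)
    (hadd : ∀ f g, Q (f + g) h = Q f h + Q g h) (hsmul : ∀ (c : ℝ) f, Q (c • f) h = c * Q f h)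
    (hpos : ∀ S : Finset P, IsUpperSet (S : Set P) → 0 ≤ Q (setInd S) h)
    (l : List (ℝ × Finset P)) (hl : ∀ p ∈ l, 0 ≤ p.1 ∧ IsUpperSet ((p.2 : Finset P) : Set P)) :
    0 ≤ Q (l.map fun p => p.1 • setInd p.2).sum h := by
  induction l with
  | nil =>
    have h0 : Q 0 h = 0 := by simpa using hsmul 0 0
    simp [h0]
  | cons p l ih =>
    rw [List.map_cons, List.sum_cons, hadd, hsmul]
    have hp := hl p (by simp)
    exact add_nonneg (mul_nonneg hp.1 (hpos p.2 hp.2)) (ih fun q hq => hl q (by simp [hq]))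

/-- **Copositivity by layer cake.**  A form `Q` that is additive and homogeneous in each argument and nonnegative on pairs of
indicators of up-sets is nonnegative on pairs of nonnegative monotone functions. [folklore] -/
theorem bilin_nonneg_of_upperSets (Q : (P → ℝ) → (P → ℝ) → ℝ)
    (hadd₁ : ∀ f g h, Q (f + g) h = Q f h + Q g h) (hsmul₁ : ∀ (c : ℝ) f h, Q (c • f) h = c * Q f h)
    (hadd₂ : ∀ f g h, Q f (g + h) = Q f g + Q f h) (hsmul₂ : ∀ (c : ℝ) f g, Q f (c • g) = c * Q f g)
    (hpos : ∀ S S' : Finset P, IsUpperSet (S : Set P) → IsUpperSet (S' : Set P) → 0 ≤ Q (setInd S) (setInd S'))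
    {x y : P → ℝ} (hx0 : ∀ t, 0 ≤ x t) (hxm : Monotone x) (hy0 : ∀ t, 0 ≤ y t) (hym : Monotone y) : 0 ≤ Q x y := by
  obtain ⟨lx, hlx, hxlx⟩ := exists_upperSet_decomposition x hx0 hxm
  obtain ⟨ly, hly, hyly⟩ := exists_upperSet_decomposition y hy0 hym
  rw [hxlx]
  refine listSum_nonneg_of_upperSets Q y (fun f g => hadd₁ f g y) (fun c f => hsmul₁ c f y) (fun S hS => ?_) lx hlx
  rw [hyly]
  -- second argument: the same one-sided lemma for the flipped form
  exact listSum_nonneg_of_upperSets (fun g f => Q f g) (setInd S) (fun f g => hadd₂ _ f g) (fun c f => hsmul₂ c _ f)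
    (fun S' hS' => hpos S S' hS hS') ly hly

/-! ### Small summation lemmas -/

omit [Fintype P] [PartialOrder P] in
/-- `Σ_{t∈X} w·1_S = Σ_{t∈X∩S} w`. [folklore] -/
theorem sum_mul_setInd (w : P → ℝ) (X S : Finset P) : ∑ t ∈ X, w t * setInd S t = ∑ t ∈ X ∩ S, w t := by
  simp only [setInd_apply, mul_ite, mul_one, mul_zero]
  rw [← Finset.sum_filter, Finset.filter_mem_eq_inter]

omit [Fintype P] [PartialOrder P] in
/-- `Σ_{t∈X} w·(1_S·1_{S'}) = Σ_{t∈X∩(S∩S')} w`. [folklore] -/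
theorem sum_mul_setInd_mul (w : P → ℝ) (X S S' : Finset P) :
    ∑ t ∈ X, w t * (setInd S t * setInd S' t) = ∑ t ∈ X ∩ (S ∩ S'), w t := by
  have e : ∀ t, setInd S t * setInd S' t = setInd (S ∩ S') t := fun t => congrFun (setInd_mul S S') t
  simp only [e]
  exact sum_mul_setInd w X (S ∩ S')

omit [Fintype P] [DecidableEq P] [PartialOrder P] in
/-- Additivity of a weighted sum in the function. [folklore] -/
theorem sum_mul_add (w f g : P → ℝ) (X : Finset P) :
    ∑ t ∈ X, w t * (f + g) t = ∑ t ∈ X, w t * f t + ∑ t ∈ X, w t * g t := by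
  rw [← Finset.sum_add_distrib]; exact Finset.sum_congr rfl fun t _ => by rw [Pi.add_apply, mul_add]

omit [Fintype P] [DecidableEq P] [PartialOrder P] in
/-- Homogeneity of a weighted sum in the function. [folklore] -/
theorem sum_mul_smul (w f : P → ℝ) (c : ℝ) (X : Finset P) :
    ∑ t ∈ X, w t * (c • f) t = c * ∑ t ∈ X, w t * f t := by
  rw [Finset.mul_sum]; exact Finset.sum_congr rfl fun t _ => by rw [Pi.smul_apply, smul_eq_mul]; ring

omit [Fintype P] [DecidableEq P] [PartialOrder P] in
/-- Additivity of a weighted sum of products in the first function. [folklore] -/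
theorem sum_mul_mul_add_left (w f g h : P → ℝ) (X : Finset P) :
    ∑ t ∈ X, w t * ((f + g) t * h t) = ∑ t ∈ X, w t * (f t * h t) + ∑ t ∈ X, w t * (g t * h t) := by
  rw [← Finset.sum_add_distrib]; exact Finset.sum_congr rfl fun t _ => by rw [Pi.add_apply]; ring

omit [Fintype P] [DecidableEq P] [PartialOrder P] in
/-- Homogeneity of a weighted sum of products in the first function. [folklore] -/
theorem sum_mul_mul_smul_left (w f h : P → ℝ) (c : ℝ) (X : Finset P) :
    ∑ t ∈ X, w t * ((c • f) t * h t) = c * ∑ t ∈ X, w t * (f t * h t) := by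
  rw [Finset.mul_sum]; exact Finset.sum_congr rfl fun t _ => by rw [Pi.smul_apply, smul_eq_mul]; ring

/-! ### The theorem -/

/-- **Sahi's `Z³E₃(1_U, 1_A, 1_B) ≥ 0` from a flow certificate on the pattern.**  Data over a finite pattern `P`: a set of fibres
`U` (the slot), fibre masses `ν`, densities `α, β ≥ 0` monotone and `γ` monotone with `γ ≥ α β`; a certificate `(R, F)` with
(R0), (F0), (F≤), (cap), (K), (pair) as in the module docstring.  Then the displayed cubic — Sahi's functional for the triple
(`U`-fibres, `A`, `B`) written in fibre data — is nonnegative. [this work] -/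
theorem phi_nonneg_of_patternCertificate (U : Finset P) (ν α β γ R : P → ℝ) (F : P → P → ℝ)
    (hα0 : ∀ t, 0 ≤ α t) (hα : Monotone α) (hβ0 : ∀ t, 0 ≤ β t) (hβ : Monotone β)
    (hγ : Monotone γ) (hγf : ∀ t, α t * β t ≤ γ t)
    (hR0 : ∀ t ∈ U, 0 ≤ R t) (hF0 : ∀ t s, 0 ≤ F t s) (hFle : ∀ t s, F t s ≠ 0 → s ≤ t)
    (hcap : ∀ t ∈ U, R t + ∑ s ∈ Uᶜ, F t s ≤ (∑ r, ν r) * ((∑ r, ν r) + ∑ r ∈ Uᶜ, ν r) * ν t)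
    (hK : ∀ s ∈ Uᶜ, (∑ r, ν r) * (∑ r ∈ U, ν r) * ν s ≤ ∑ t ∈ U, F t s)
    (hpair : ∀ S S' : Finset P, IsUpperSet (S : Set P) → IsUpperSet (S' : Set P) →
      (∑ r, ν r) * ((∑ t ∈ S, ν t) * (∑ t ∈ S' ∩ U, ν t) + (∑ t ∈ S', ν t) * (∑ t ∈ S ∩ U, ν t))
          - (∑ r ∈ U, ν r) * (∑ t ∈ S, ν t) * (∑ t ∈ S', ν t)
        ≤ ∑ t ∈ (S ∩ S') ∩ U, R t + ∑ s ∈ (S ∩ S') ∩ Uᶜ, (∑ t ∈ U, F t s - (∑ r, ν r) * (∑ r ∈ U, ν r) * ν s)) :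
    0 ≤ 2 * (∑ t, ν t) ^ 2 * (∑ t ∈ U, ν t * γ t)
        + (∑ t ∈ U, ν t) * (∑ t, ν t * α t) * (∑ t, ν t * β t)
        - (∑ t, ν t) * ((∑ t ∈ U, ν t) * (∑ t, ν t * γ t) + (∑ t, ν t * α t) * (∑ t ∈ U, ν t * β t)
            + (∑ t, ν t * β t) * (∑ t ∈ U, ν t * α t)) := by
  set Z := ∑ t, ν t with hZdef
  set NU := ∑ t ∈ U, ν t with hNUdef
  set ND := ∑ t ∈ Uᶜ, ν t with hNDdef
  have hZsplit : Z = NU + ND := (Finset.sum_add_sum_compl U ν).symm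
  have sC : ∑ t, ν t * γ t = (∑ t ∈ U, ν t * γ t) + ∑ t ∈ Uᶜ, ν t * γ t :=
    (Finset.sum_add_sum_compl U fun t => ν t * γ t).symm
  -- step 1a: the `U`-terms
  have L1 : 0 ≤ ∑ t ∈ U, (Z * (Z + ND) * (ν t * γ t) - R t * (α t * β t) - ∑ s ∈ Uᶜ, F t s * γ s) := by
    refine Finset.sum_nonneg fun t ht => ?_
    have hγt : 0 ≤ γ t := le_trans (mul_nonneg (hα0 t) (hβ0 t)) (hγf t)
    have h1 : (R t + ∑ s ∈ Uᶜ, F t s) * γ t ≤ Z * (Z + ND) * ν t * γ t :=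
      mul_le_mul_of_nonneg_right (hcap t ht) hγt
    have h2 : R t * (α t * β t) ≤ R t * γ t := mul_le_mul_of_nonneg_left (hγf t) (hR0 t ht)
    have h3 : ∑ s ∈ Uᶜ, F t s * γ s ≤ (∑ s ∈ Uᶜ, F t s) * γ t := by
      rw [Finset.sum_mul]
      refine Finset.sum_le_sum fun s _ => ?_
      by_cases h0 : F t s = 0
      · rw [h0, zero_mul, zero_mul]
      · exact mul_le_mul_of_nonneg_left (hγ (hFle t s h0)) (hF0 t s)
    nlinarith [h1, h2, h3]
  -- step 1b: the `Uᶜ`-terms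
  have L2 : 0 ≤ ∑ s ∈ Uᶜ, ((∑ t ∈ U, F t s) * γ s - Z * NU * (ν s * γ s)
      - (∑ t ∈ U, F t s - Z * NU * ν s) * (α s * β s)) := by
    refine Finset.sum_nonneg fun s hs => ?_
    have e : (∑ t ∈ U, F t s) * γ s - Z * NU * (ν s * γ s) - (∑ t ∈ U, F t s - Z * NU * ν s) * (α s * β s) =
        (∑ t ∈ U, F t s - Z * NU * ν s) * (γ s - α s * β s) := by ring
    rw [e]
    exact mul_nonneg (sub_nonneg.2 (hK s hs)) (sub_nonneg.2 (hγf s))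
  -- the double sum, both ways
  have hswap : ∑ t ∈ U, ∑ s ∈ Uᶜ, F t s * γ s = ∑ s ∈ Uᶜ, (∑ t ∈ U, F t s) * γ s := by
    rw [Finset.sum_comm]
    exact Finset.sum_congr rfl fun s _ => by rw [Finset.sum_mul]
  have eL1 : ∑ t ∈ U, (Z * (Z + ND) * (ν t * γ t) - R t * (α t * β t) - ∑ s ∈ Uᶜ, F t s * γ s) =
      Z * (Z + ND) * (∑ t ∈ U, ν t * γ t) - (∑ t ∈ U, R t * (α t * β t)) - ∑ s ∈ Uᶜ, (∑ t ∈ U, F t s) * γ s := by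
    rw [Finset.sum_sub_distrib, Finset.sum_sub_distrib, ← Finset.mul_sum, hswap]
  have eL2 : ∑ s ∈ Uᶜ, ((∑ t ∈ U, F t s) * γ s - Z * NU * (ν s * γ s)
      - (∑ t ∈ U, F t s - Z * NU * ν s) * (α s * β s)) =
      (∑ s ∈ Uᶜ, (∑ t ∈ U, F t s) * γ s) - Z * NU * (∑ s ∈ Uᶜ, ν s * γ s)
        - ∑ s ∈ Uᶜ, (∑ t ∈ U, F t s - Z * NU * ν s) * (α s * β s) := by
    rw [Finset.sum_sub_distrib, Finset.sum_sub_distrib, ← Finset.mul_sum]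
  rw [eL1] at L1
  rw [eL2] at L2
  -- step 2: the bilinear form
  have hQ : 0 ≤ (∑ t ∈ U, R t * (α t * β t)) + (∑ s ∈ Uᶜ, (∑ t ∈ U, F t s - Z * NU * ν s) * (α s * β s))
      + NU * (∑ t, ν t * α t) * (∑ t, ν t * β t) - Z * (∑ t, ν t * α t) * (∑ t ∈ U, ν t * β t)
      - Z * (∑ t, ν t * β t) * (∑ t ∈ U, ν t * α t) := by
    have key := bilin_nonneg_of_upperSets
      (fun a b : P → ℝ => (∑ t ∈ U, R t * (a t * b t)) + (∑ s ∈ Uᶜ, (∑ t ∈ U, F t s - Z * NU * ν s) * (a s * b s))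
        + NU * (∑ t, ν t * a t) * (∑ t, ν t * b t) - Z * (∑ t, ν t * a t) * (∑ t ∈ U, ν t * b t)
        - Z * (∑ t, ν t * b t) * (∑ t ∈ U, ν t * a t))
      (fun f g h => by
        simp only [sum_mul_mul_add_left, sum_mul_add]; ring)
      (fun c f h => by
        simp only [sum_mul_mul_smul_left, sum_mul_smul]; ring)
      (fun f g h => by
        simp only [mul_comm (f _) _, sum_mul_mul_add_left, sum_mul_add]; ring)
      (fun c f g => by
        simp only [mul_comm (f _) _, sum_mul_mul_smul_left, sum_mul_smul]; ring)
      (fun S S' hS hS' => by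
        simp only [sum_mul_setInd_mul, sum_mul_setInd, Finset.univ_inter]
        have h := hpair S S' hS hS'
        rw [Finset.inter_comm U (S ∩ S'), Finset.inter_comm Uᶜ (S ∩ S'), Finset.inter_comm U S', Finset.inter_comm U S]
        linarith)
      hα0 hα hβ0 hβ
    exact key
  -- assemble: the target is `L1 + L2 + hQ` up to `Z = N_U + N_D`
  have e : 2 * Z ^ 2 * (∑ t ∈ U, ν t * γ t) + NU * (∑ t, ν t * α t) * (∑ t, ν t * β t)
      - Z * (NU * ((∑ t ∈ U, ν t * γ t) + ∑ t ∈ Uᶜ, ν t * γ t) + (∑ t, ν t * α t) * (∑ t ∈ U, ν t * β t)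
          + (∑ t, ν t * β t) * (∑ t ∈ U, ν t * α t)) =
      (Z * (Z + ND) * (∑ t ∈ U, ν t * γ t) - (∑ t ∈ U, R t * (α t * β t)) - ∑ s ∈ Uᶜ, (∑ t ∈ U, F t s) * γ s)
      + ((∑ s ∈ Uᶜ, (∑ t ∈ U, F t s) * γ s) - Z * NU * (∑ s ∈ Uᶜ, ν s * γ s)
          - ∑ s ∈ Uᶜ, (∑ t ∈ U, F t s - Z * NU * ν s) * (α s * β s))
      + ((∑ t ∈ U, R t * (α t * β t)) + (∑ s ∈ Uᶜ, (∑ t ∈ U, F t s - Z * NU * ν s) * (α s * β s))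
          + NU * (∑ t, ν t * α t) * (∑ t, ν t * β t) - Z * (∑ t, ν t * α t) * (∑ t ∈ U, ν t * β t)
          - Z * (∑ t, ν t * β t) * (∑ t ∈ U, ν t * α t)) := by
    rw [hZsplit]; ring
  rw [sC]
  linarith [L1, L2, hQ, e]

/-! ### Lattice form: the preimage of a pattern set under `x ↦ (j i ≤ x)_i` -/

section Lattice

open Literature.Probability.LatticeModels SahiE3HitSlotCertificate

variable {α : Type*} [DistribLattice α] [Fintype α] [DecidableEq α] [DecidableLE α]
variable {ι : Type*} [Fintype ι] [DecidableEq ι]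

omit [DecidableEq ι] in
/-- Membership in a fibre is having that pattern. [this work] -/
theorem mem_fib_iff_pat {j : ι → α} {F : (ι → Bool) → Finset α}
    (hF : ∀ (t : ι → Bool) (x : α), x ∈ F t ↔ ∀ i, (j i ≤ x ↔ t i = true)) (t : ι → Bool) (x : α) :
    x ∈ F t ↔ (fun i => decide (j i ≤ x)) = t := by
  have h := inter_fib_eq_filter hF (univ : Finset α) t
  rw [Finset.univ_inter] at h
  rw [h, Finset.mem_filter]
  simp

omit [DecidableEq ι] in
/-- `m(U ∩ S) = Σ_{t ∈ U'} m(S ∩ F_t)` for the preimage `U` of a pattern set `U'`. [this work] -/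
theorem mass_pre_inter_eq [DecidableEq ι] (μ : α → ℝ) {j : ι → α} {F : (ι → Bool) → Finset α}
    (hF : ∀ (t : ι → Bool) (x : α), x ∈ F t ↔ ∀ i, (j i ≤ x ↔ t i = true)) (U' : Finset (ι → Bool)) (S : Finset α) :
    mass μ ((univ.filter fun x => (fun i => decide (j i ≤ x)) ∈ U') ∩ S) = ∑ t ∈ U', mass μ (S ∩ F t) := by
  rw [mass_eq_sum_fib μ hF, ← Finset.sum_add_sum_compl U']
  have e1 : ∀ t ∈ U', (univ.filter fun x => (fun i => decide (j i ≤ x)) ∈ U') ∩ S ∩ F t = S ∩ F t := by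
    intro t ht
    ext x
    simp only [Finset.mem_inter, Finset.mem_filter, Finset.mem_univ, true_and]
    constructor
    · rintro ⟨⟨-, h1⟩, h2⟩; exact ⟨h1, h2⟩
    · rintro ⟨h1, h2⟩
      refine ⟨⟨?_, h1⟩, h2⟩
      rw [(mem_fib_iff_pat hF t x).1 h2]; exact ht
  have e0 : ∀ t ∈ U'ᶜ, (univ.filter fun x => (fun i => decide (j i ≤ x)) ∈ U') ∩ S ∩ F t = ∅ := by
    intro t ht
    rw [Finset.mem_compl] at ht
    ext x
    simp only [Finset.mem_inter, Finset.mem_filter, Finset.mem_univ, true_and, Finset.notMem_empty, iff_false, not_and]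
    intro h1 h2
    rw [(mem_fib_iff_pat hF t x).1 h2] at h1
    exact ht h1.1
  have s1 : ∑ t ∈ U', mass μ ((univ.filter fun x => (fun i => decide (j i ≤ x)) ∈ U') ∩ S ∩ F t) =
      ∑ t ∈ U', mass μ (S ∩ F t) := Finset.sum_congr rfl fun t ht => by rw [e1 t ht]
  have s0 : ∑ t ∈ U'ᶜ, mass μ ((univ.filter fun x => (fun i => decide (j i ≤ x)) ∈ U') ∩ S ∩ F t) = 0 :=
    Finset.sum_eq_zero fun t ht => by rw [e0 t ht]; unfold mass; simp
  rw [s1, s0, add_zero]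

open scoped Classical in
/-- **FKG slot-locality for an arbitrary junta pattern, from a flow certificate on the pattern measure.**  `μ ≥ 0` log-supermodular
on a finite distributive lattice, `j : ι → α` join-primes with pattern fibres `F_t` (`hF`), `ν_t = m(F_t)`, `A, B` up-sets, `U'` any
finite set of patterns.  If `(R, Fl)` is a flow certificate for `(U', ν)` — (R0), (F0), (F≤), (cap), (K), (pair) of
`phi_nonneg_of_patternCertificate` — then `0 ≤ latticeE3 μ U A B` for the preimage slot `U = {x | (j i ≤ x)_i ∈ U'}`. [this work] -/
theorem latticeE3_nonneg_of_patternCertificate {μ : α → ℝ} (hμ₀ : 0 ≤ μ)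
    (hμ : ∀ a b, μ a * μ b ≤ μ (a ⊓ b) * μ (a ⊔ b)) {j : ι → α} (hj : ∀ i, SupPrime (j i))
    {F : (ι → Bool) → Finset α} (hF : ∀ (t : ι → Bool) (x : α), x ∈ F t ↔ ∀ i, (j i ≤ x ↔ t i = true))
    {A B : Finset α} (hA : IsUpperSet (A : Set α)) (hB : IsUpperSet (B : Set α)) (U' : Finset (ι → Bool))
    (ν : (ι → Bool) → ℝ) (hν : ∀ t, ν t = mass μ (F t)) (R : (ι → Bool) → ℝ) (Fl : (ι → Bool) → (ι → Bool) → ℝ)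
    (hR0 : ∀ t ∈ U', 0 ≤ R t) (hF0 : ∀ t s, 0 ≤ Fl t s) (hFle : ∀ t s, Fl t s ≠ 0 → s ≤ t)
    (hcap : ∀ t ∈ U', R t + ∑ s ∈ U'ᶜ, Fl t s ≤ (∑ r, ν r) * ((∑ r, ν r) + ∑ r ∈ U'ᶜ, ν r) * ν t)
    (hK : ∀ s ∈ U'ᶜ, (∑ r, ν r) * (∑ r ∈ U', ν r) * ν s ≤ ∑ t ∈ U', Fl t s)
    (hpair : ∀ S S' : Finset (ι → Bool), IsUpperSet (S : Set (ι → Bool)) → IsUpperSet (S' : Set (ι → Bool)) →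
      (∑ r, ν r) * ((∑ t ∈ S, ν t) * (∑ t ∈ S' ∩ U', ν t) + (∑ t ∈ S', ν t) * (∑ t ∈ S ∩ U', ν t))
          - (∑ r ∈ U', ν r) * (∑ t ∈ S, ν t) * (∑ t ∈ S', ν t)
        ≤ ∑ t ∈ (S ∩ S') ∩ U', R t + ∑ s ∈ (S ∩ S') ∩ U'ᶜ, (∑ t ∈ U', Fl t s - (∑ r, ν r) * (∑ r ∈ U', ν r) * ν s)) :
    0 ≤ latticeE3 μ (univ.filter fun x => (fun i => decide (j i ≤ x)) ∈ U') A B := by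
  -- densities with phantom values on null fibres
  set α' : (ι → Bool) → ℝ := fun t =>
    (univ.filter fun s => s ≤ t).sup' ⟨t, by simp⟩ fun s => mass μ (A ∩ F s) / mass μ (F s) with hα'
  set β' : (ι → Bool) → ℝ := fun t =>
    (univ.filter fun s => s ≤ t).sup' ⟨t, by simp⟩ fun s => mass μ (B ∩ F s) / mass μ (F s) with hβ'
  set γ₀ : (ι → Bool) → ℝ := fun t =>
    (univ.filter fun s => s ≤ t).sup' ⟨t, by simp⟩ fun s => mass μ (A ∩ B ∩ F s) / mass μ (F s) with hγ₀
  set γ' : (ι → Bool) → ℝ := fun t => max (γ₀ t) (α' t * β' t) with hγ'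
  have hAB : IsUpperSet ((A ∩ B : Finset α) : Set α) := by rw [Finset.coe_inter]; exact hA.inter hB
  have hαm : Monotone α' := env_mono μ F A
  have hβm : Monotone β' := env_mono μ F B
  have hγ₀m : Monotone γ₀ := env_mono μ F (A ∩ B)
  have hα0 : ∀ t, 0 ≤ α' t := fun t => env_nonneg hμ₀ F A t
  have hβ0 : ∀ t, 0 ≤ β' t := fun t => env_nonneg hμ₀ F B t
  have hγm : Monotone γ' := fun s t hst =>
    max_le_max (hγ₀m hst) (mul_le_mul (hαm hst) (hβm hst) (hβ0 s) (hα0 t))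
  -- mass identities `ν·density = fibre mass`
  have eA : ∀ t, ν t * α' t = mass μ (A ∩ F t) := fun t => by rw [hν]; exact mass_mul_env hμ₀ hμ hj hF hA t
  have eB : ∀ t, ν t * β' t = mass μ (B ∩ F t) := fun t => by rw [hν]; exact mass_mul_env hμ₀ hμ hj hF hB t
  have eC : ∀ t, ν t * γ' t = mass μ (A ∩ B ∩ F t) := by
    intro t
    rw [hν]
    rcases (mass_nonneg hμ₀ (F t)).eq_or_lt with h0 | hpos
    · have hXt : mass μ (A ∩ B ∩ F t) = 0 :=
        le_antisymm (le_trans (mass_mono hμ₀ Finset.inter_subset_right) h0.symm.le) (mass_nonneg hμ₀ _)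
      rw [← h0, hXt, zero_mul]
    · have e1 : γ₀ t = mass μ (A ∩ B ∩ F t) / mass μ (F t) := env_eq_dens hμ₀ hμ hj hF hAB hpos
      have e2 : α' t = mass μ (A ∩ F t) / mass μ (F t) := env_eq_dens hμ₀ hμ hj hF hA hpos
      have e3 : β' t = mass μ (B ∩ F t) / mass μ (F t) := env_eq_dens hμ₀ hμ hj hF hB hpos
      have hle : α' t * β' t ≤ γ₀ t := by
        rw [e1, e2, e3]; exact dens_mul_dens_le hμ₀ hμ hj hF hA hB hpos
      show mass μ (F t) * max (γ₀ t) (α' t * β' t) = _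
      rw [max_eq_left hle, e1, mul_div_cancel₀ _ hpos.ne']
  -- the pattern theorem
  have key := phi_nonneg_of_patternCertificate U' ν α' β' γ' R Fl hα0 hαm hβ0 hβm hγm (fun t => le_max_right _ _)
    hR0 hF0 hFle hcap hK hpair
  -- translate sums of fibre data into masses
  have sν : ∑ t, ν t = mass μ univ := by
    rw [mass_eq_sum_fib μ hF univ]; exact Finset.sum_congr rfl fun t _ => by rw [hν, Finset.univ_inter]
  have sνU : ∑ t ∈ U', ν t = mass μ (univ.filter fun x => (fun i => decide (j i ≤ x)) ∈ U') := by
    rw [← Finset.inter_univ (univ.filter fun x => (fun i => decide (j i ≤ x)) ∈ U'), mass_pre_inter_eq μ hF U' univ]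
    exact Finset.sum_congr rfl fun t _ => by rw [hν, Finset.univ_inter]
  have sA : ∑ t, ν t * α' t = mass μ A := by
    rw [mass_eq_sum_fib μ hF A]; exact Finset.sum_congr rfl fun t _ => eA t
  have sB : ∑ t, ν t * β' t = mass μ B := by
    rw [mass_eq_sum_fib μ hF B]; exact Finset.sum_congr rfl fun t _ => eB t
  have sC : ∑ t, ν t * γ' t = mass μ (A ∩ B) := by
    rw [mass_eq_sum_fib μ hF (A ∩ B)]; exact Finset.sum_congr rfl fun t _ => eC t
  have sUA : ∑ t ∈ U', ν t * α' t = mass μ ((univ.filter fun x => (fun i => decide (j i ≤ x)) ∈ U') ∩ A) := by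
    rw [mass_pre_inter_eq μ hF U' A]; exact Finset.sum_congr rfl fun t _ => eA t
  have sUB : ∑ t ∈ U', ν t * β' t = mass μ ((univ.filter fun x => (fun i => decide (j i ≤ x)) ∈ U') ∩ B) := by
    rw [mass_pre_inter_eq μ hF U' B]; exact Finset.sum_congr rfl fun t _ => eB t
  have sUC : ∑ t ∈ U', ν t * γ' t = mass μ ((univ.filter fun x => (fun i => decide (j i ≤ x)) ∈ U') ∩ A ∩ B) := by
    rw [Finset.inter_assoc, mass_pre_inter_eq μ hF U' (A ∩ B)]; exact Finset.sum_congr rfl fun t _ => eC t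
  rw [sν, sνU, sA, sB, sC, sUA, sUB, sUC] at key
  unfold latticeE3
  linarith [key]

end Lattice

end Summit.CriticalPhenomena.PercolationContinuityZ3.Theorems.SahiE3PatternCertificate
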